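import Summits.QuantumFields.BalabanUV.T4Continuum.Support.ShellMeasureLandauEndAssembledDecayCfLinCoTestsSchurCoarseReadOuts
import Summits.QuantumFields.BalabanUV.T4Continuum.Support.ShellMeasureThresholdUnits

/-!
# `T4Continuum.ShellMeasureLiveEndOneCallSlotLevelsCfLinJunction` — row S111 file 1⁶: THE LIVE-LEVEL END-II AFTER THE JUNCTION WAVE (the chain-end
# host `ShellMeasureLandauEndAssembledDecayCfLinCoTestsSchurCoarseReadOuts` ∘ the γ8 unit change S90) OVER THE INDEXED, LEVEL-LIFTED
# FAMILIES, for BOTH runs and every slot — END-I's `hacA`∕`hacB` shape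
(cell `pub-balaban`, sub-cell `t4`, spine estimate NE7c (node U5b); NE7c ROUND-2 crew, unit `b2b-balaban-t4-ne7c-formalise-leaf-09`
gen 14; owner table `t4/b2b-balaban-t4-ne7c-p1/LEAVES-NE7c-P1.md` row **S111** «THE ONE CALL v5 — THE JUNCTION WAVE COLLECTED»
(R-ne7cp1-g36-12 (5) ∕ R-ne7cp1-g36-13, booked-ahead leaf-09); ADDITIVE — imports the chain-end host
`ShellMeasureLandauEndAssembledDecayCfLinCoTestsSchurCoarseReadOuts` and S90 `ShellMeasureThresholdUnits` ONLY; [folklore]; 0 `def`, 0 `def … : Prop`,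
0 sorry, 0 citation tags; the statement is GENERATED from the host's signature by the S92∕S95∕S102∕S105∕S107 script re-pointed —
`HOME/b2b-balaban-t4-ne7c-formalise-leaf-09/g14/s107v5/`)

HONEST FRAMING.  Finite four-torus programme, rung (B)+1 only — NOT infinite volume, NOT a mass gap, NOT the Clay problem, NOT
summit progress; (B), `BetaPertHyp`, (B^μ) not consumed.  NE7c (`T4IndicatorShell.ShellWeightBound`) is NOT PRINTED in
[Balaban 1983–89] and NOT PROVED; «NE7c ⇐ the named binders» (trigger c3): every binder below is DISPLAYED, asserted by nobody;
no estimate of Bałaban's is discharged; (M1) realized ≠ NE7c.  Equation numbers in comments LOCATE displayed shapes, not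
citations.  HONEST DEPENDENCY (cell): continuum YM on T⁴ ⇐ BetaPertH ∧ nine spine estimates (0/9 proved); BetaPertH ⇐ (D1) ∧ (D4)
∧ CAP+tail; G-an2-4 gates asym, D1 and NE2/3/4.

THE JUNCTION WAVE (owner R-ne7cp1-g36-12: ONE host chain, each link a wrapper over the previous host with conclusion IDENTICAL, LEAVING∕ENTERING
lists in every header; then ONE re-fire of THE ONE CALL — this row, R-ne7cp1-g36-13). The chain as landed: (1) S108 f2
`ShellMeasureLandauEndAssembledDecayCfLinCoTestsSchur` (leaf-04-g11, p239037) → (2) S108 f3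
`ShellMeasureLandauEndAssembledDecayCfLinCoTestsSchurElb` (leaf-07-g10, p239416) → (3) S110
`ShellMeasureLandauEndAssembledDecayCfLinCoTestsSchurCoarse` (leaf-03-g9, p239707) → (4) S109 f2
`ShellMeasureLandauEndAssembledDecayCfLinCoTestsSchurCoarseReadOuts` (leaf-08-g17, p240165). Binder movements, mechanically (top-level binder NAMES
of each link against the previous host; my `namediff.py`, the links' own headers agree): link (1): LEAVING `h𝒢w hH₁w hHw he0 hLK hBd0`, ENTERING
`hdis hB𝒢w hBH₁w hBHw`; link (2): LEAVING `hElb₁ (+ implicit BE₁)`, NOTHING entering; link (3): LEAVING `ϖw dis hϖw hdis hM𝒢 hM𝒢′ hMι hMι′ hMH hMH′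
hMH₁ hMH₁′ (+ implicit type 𝔖)`, ENTERING `Bref hBref hmultw hmultz hmultx hmultb hgap𝒢 hM𝒢c hgapι hMιc hgapH hMHc hgapH₁ hMH₁c (+ implicit Nc multw
multz multx multb, instance NeZero Nc)`; link (4): LEAVING `ℓs hκ hℓ hlen hκc hcurl hs₁ ha hma (+ implicit κr κc m, the section variable 𝒴)`,
ENTERING `plq Λu U₀u hU₀u wu wu′ hw₀ hw₀′ hfl hfl′ hη1 hs₁′ ha′ hma′ (+ implicit w₀ w₀′, instances Fact (0 < wu ·) ∕ Fact (0 < wu′ ·))`. In words: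
(1) the w-tuple's three sup-norm operator rows `h𝒢w hH₁w hHw` (R06∕R09) DERIVED by the ∞→∞ Schur test (S108 f1
`ShellMeasureDecayKernelSchur.norm_kerOp_le_of_decay_junction_family`) from the displayed decay rows `hk·`, reduced-rate sums `hM·′`, the margin
`hδw`, ONE structural sign row `hdis : 0 ≤ dis` and three number junctions `hB·w : c·M· ≤ B₀w`; the (T3)∕(S78) sign rows `he0 hLK hBd0` DERIVED from
`hEb`∕`hrE`, `hK`, `hA`∕`hpos`∕`hS`. (2) the 𝓔-leg lower bound `hElb₁` DERIVED from `hEb` + `hcoupE` (S108 f3a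
`ShellMeasureRayTermsPinnedLower.hElb_landau_chartRay_pinned_linear`, `BE₁` instantiated in-proof). (3) the w-tuple's position space, distance and
pin FIXED to the designed COARSE-BLOCKED reading (`𝔖 := TPt P.d Nc` unit cells, `dis := pl1`, `ϖw := pinDist Bref`): the four reduced-rate row sums
`hM·′`, their signs `hM·`, the pin row `hϖw` and `hdis` DERIVED as torus geometry (S98 `rowSum_coarse_le`, S69 `pinDist_le_add`, `pl1_nonneg`);
entering per-slot `Nc`, `Bref`, placement multiplicities `hmult·`, rate gaps `hgap·` and OUR number junctions `hM·c`; the decay rows `hk·` stay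
displayed (cell-indexed kernels — the aggregation of Bałaban's fine kernels to cells is visible in the TYPE, not discharged). (4) the u-tuple's
ABSTRACT carrier `𝒴` READ as the (19)∕(98) source space `Ysp Λu η U₀u wu wu′` (S65 f2c `WMax` with the `∇^η_{U₀}`-datum, S109 f1) on the block's
fine bonds and the classifier letters := the four (Ad-twisted) lattice-angle read-outs `plaqReadOuts` of `∂p` at a placement `plq`: R12∕R13's `hκ hℓ
hlen hκc hcurl` DERIVED (`κr := η∕w₀`, `κc := 2η²∕w₀′²`, `m := 4`) and the (SM) rows re-sourced to the η-FREE numbers `hs₁′ ha′ hma′` + `hη1 : η ≤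
1` (S95's lift rule by construction); the u-tuple's remaining W-a rows `h𝒢 hW hH₁ hH hι` are from now on DISPLAYED IN PRINT's (19)-NORM on the block
(owner's sentence (i): a sharpening of the reading, class T unchanged — where [B9] Thm 3.13 ∕ B11 Prop. 4 would have to be proved; (ii) nothing of
B11 (19)–(37) discharged). Every LEAVING row is either (α) a logical consequence of OTHER displayed rows (Schur test, signs, lower bounds) or (β) a
kernel fact about OUR designed objects once an abstract carrier∕index type is READ as its designed instance; NOTHING of Bałaban's is discharged —
the CONTENT rows (propagator ∕ (P4) ∕ linear maps, decay kernels, sectioned non-Wilson terms, the located background regularity, the neighbours'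
(AN-bound)) stay displayed, asserted by nobody.

WHAT IS PROVED ([folklore]). **`hac_live_of_assembled_decay_levels_cfB7_lin_junction`**: for a run index `r : Bool`, comparison index `K`, source
parameter `t` and slot `s : σ`, with the slot on its own lattice `(P r K s, jl r K s)` (lattice level `jl`; END-I level `lvl`), EVERY binder of the
chain-end host `slotAC_realized_su2_landauChart_assembled_decay_cfB7_lin_coTests_schur_elb_coarse_readOuts` as a FAMILY — the TYPE families and the
box ∕ chart ∕ coarse-torus geometry (`lo hi nb Λ m₀ e`, the level `k`, the B7 index sets `Sf Sf′ Sw Sw′ Se Se′`, the cells-per-direction `Nc` where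
bound) by `(r, K, s)`, every other object by `(r, K, t, s)`, hypotheses quantified unguarded over exactly the indices they mention; Bałaban's
UNIFORM NUMBERS SHARED across runs and slots; the η-scaled numbers (`κwb κcb dbar Kw`, and `κr κc` where still bound) `: Bool → ℕ → ℝ` read at the
slot's LATTICE level (S95's LIFT RULE); the profiles `ε η ρ β : Bool → ℕ → ℝ` ⟹ `∀ r K t s, SlotAntiConcentration ((fieldMeasure (P r K s) (jl r K
s) SU2).withDensity (F r K t s)) (u r K t s ∕ η r (jl r K s)²) (ε r (K − lvl r K s)) (ρ r (lvl r K s)) (the host's slot constant at (r, K, t, s))` —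
ONE call of the host at `(εθ, η) := (ε r (K − lvl r K s), η r (jl r K s))`, then S90 `slotAntiConcentration_thresholdUnits`. Renamings forced by
END-I's names (as since S92): classifier index type `ιc`, S78's exponent `Aex`, (SM) letter `zs`, the linear chart map `TΦ`; the e-reach's bound
variable `b`.
-/

noncomputable section

open Set Metric NormedSpace MeasureTheory Function Finset
open scoped ENNReal

namespace Summit.QuantumFields.BalabanUV.T4Continuum.ShellMeasureLiveEndOneCallSlotLevelsCfLinJunction

open Literature.MathematicalPhysics.QuantumFieldTheory.Balaban1983to89
open B11Prop6Scheme (Prop4Hyp)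
open GaugeField (GaugeInvariant)
open T4ShellMeasure (SlotAntiConcentration)
open T4CubePoincare (cube)
open T4CubeChartGnomonic (SU2)
open T4CubeChartExp (expFibreChart)
open T4TreeGaugeFixing (NoClosedLoop fixTo)
open T4ShellMeasurePlaquette (expTail₂)
open ShellMeasureLevelAssembly (classifier)
open ShellMeasureMultiGridNorms (WSup)
open ShellMeasurePinnedNorm (pinW)
open ShellMeasureDecayKernelSums (kerOp)
open ShellMeasureLandauHolonomy (solAt landauExp)
open ShellMeasureLandauHolonomyChart (holOf cplx)
open ShellMeasureLandauHolonomySkew (readOutReal)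
open ShellMeasureMultiGridNorms.WSup (toPiL)
open T4AxialGaugeSmallField (boxPlaqs boxBonds)
open T4AxialGaugeFixing (combBonds)
open B7Prop2Explicit (C0 c2' unitaryUnits)
open B7Prop1Local (pdevOn loK bondHiK)
open B7Prop5Flat (BondIn)
open ShellMeasureAverageProp4General (O1cov C2cov)
open ShellMeasureLandauCorrectionB7 (landauCf landauRad)
open ShellMeasureLandauCorrectionReal (skewPi)
open ShellMeasureLandauCfBoxLocal (landauCfBox)
open ShellMeasureThresholdUnits (slotAntiConcentration_thresholdUnits)
open ShellMeasureLandauEndAssembledDecayCfLinCoTestsSchurCoarseReadOuts (slotAC_realized_su2_landauChart_assembled_decay_cfB7_lin_coTests_schur_elb_coarse_readOuts)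

open TreeLengthTorus (TPt)
open B12Decay510Torus (pl1)
open ShellMeasurePinnedNorm (pinDist)
open ShellMeasureCommutatorCovDatum (covIdx covD)
open B7Prop1Explicit (U1)
open ShellMeasureReadOutsMax (Ysp plaqReadOuts)
open scoped Matrix.Norms.L2Operator

variable {σ : Type*} {n : Type*} [Fintype n] [DecidableEq n] [Nonempty n]

/-- **THE LIVE-LEVEL END-II AFTER THE JUNCTION WAVE, IN THRESHOLD UNITS, OVER THE INDEXED FAMILIES** (row S111 file 1⁶; see the
module docstring).  CONDITIONAL on every displayed binder; nothing PRINTED is asserted; NOT Bałaban's minimiser; NE7c NOT PROVED. [folklore] -/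
theorem hac_live_of_assembled_decay_levels_cfB7_lin_junction
    (P : Bool → ℕ → σ → Params) (jl lvl : Bool → ℕ → σ → ℕ) [∀ r K s, DecidableEq (PBond (P r K s) (jl r K s))]
    {ε η ρ β : Bool → ℕ → ℝ} (hη : ∀ r j, 0 < η r j) (hε : ∀ r a, 0 < ε r a) (hρ0 : ∀ r j, 0 ≤ ρ r j)
    {𝒵 ℬ : Bool → ℕ → σ → Type*} [∀ r K s, NormedAddCommGroup (𝒵 r K s)] [∀ r K s, NormedSpace ℂ (𝒵 r K s)] [∀ r K s, NormedAddCommGroup (ℬ r K s)]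
    [∀ r K s, NormedSpace ℂ (ℬ r K s)] {𝔸 : Bool → ℕ → σ → Type*} [∀ r K s, CStarAlgebra (𝔸 r K s)] [∀ r K s, Nontrivial (𝔸 r K s)]
    {lo hi : ∀ r K s, Fin (P r K s).d → ℤ} {nb : Bool → ℕ → σ → ℕ} (hn : ∀ r K s, ∀ κ, hi r K s κ ≤ lo r K s κ + nb r K s)
    (hN : ∀ r K s, ∀ κ, hi r K s κ - lo r K s κ < (P r K s).sitesPerDir (jl r K s)) (Λ : ∀ r K s, Finset (PBond (P r K s) (jl r K s)))
    (hΛbox : ∀ r K s, ∀ b ∈ Λ r K s, b ∈ boxBonds (lo r K s) (hi r K s)) (hΛcomb : ∀ r K s, Disjoint (Λ r K s) (combBonds (lo r K s) (hi r K s)))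
    {m₀ : Bool → ℕ → σ → ℕ} (e : ∀ r K s, ↥(Λ r K s) × Fin 3 ≃ Fin (m₀ r K s)) {S : ℝ} (hS : 0 < S) (hSπ : 3 * S ^ 2 < Real.pi ^ 2)
    {F : ∀ r K (t : ℝ) s, GaugeField (P r K s) (jl r K s) SU2 → ℝ≥0∞} (hF : ∀ r K t s, Measurable (F r K t s))
    (hFi : ∀ r K t s, GaugeInvariant (F r K t s)) {u : ∀ r K (t : ℝ) s, GaugeField (P r K s) (jl r K s) SU2 → ℝ}
    (hu : ∀ r K t s, Measurable (u r K t s)) (hui : ∀ r K t s, GaugeInvariant (u r K t s)) {ιc : Bool → ℕ → σ → Type*}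
    {Pu : ∀ r K (t : ℝ) s, Finset (ιc r K s)} (hPu : ∀ r K t s, (Pu r K t s).Nonempty)
    -- the classifier's plaquettes PLACED on the fine lattice: `plq p = (x, μ, ν)` ⇒ `ℓs p :=` the four (Ad-twiste …
    (plq : ∀ r K (t : ℝ) s, ιc r K s → B7Prop1Explicit.Site (P r K s).d × Fin (P r K s).d × Fin (P r K s).d) {κN : Bool → ℕ → σ → Type*}
    (N : ∀ r K (t : ℝ) s, Finset (κN r K s)) {ιN : ∀ r K s, κN r K s → Type*} {PuN : ∀ r K (t : ℝ) s, (i : κN r K s) → Finset (ιN r K s i)}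
    (hPuN : ∀ r K t s, ∀ i, (PuN r K t s i).Nonempty) {AN : Bool → ℕ → σ → Type*} [∀ r K s, NormedRing (AN r K s)]
    [∀ r K s, NormedAlgebra ℂ (AN r K s)] [∀ r K s, CompleteSpace (AN r K s)]
    (holN : ∀ r K (t : ℝ) s, (i : κN r K s) → GaugeField (P r K s) (jl r K s) SU2 → ιN r K s i → (Fin (m₀ r K s) → ℝ) → AN r K s)
    {θN RN HN δN : ∀ r K (t : ℝ) s, κN r K s → ℝ} (hRN : ∀ r K t s, ∀ i ∈ N r K t s, 1 < RN r K t s i)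
    (hθN : ∀ r K t s, ∀ i ∈ N r K t s, 0 < θN r K t s i) (hδ0N : ∀ r K t s, ∀ i ∈ N r K t s, 0 ≤ δN r K t s i)
    (hδ1N : ∀ r K t s, ∀ i ∈ N r K t s, δN r K t s i ≤ 1)
    (hSMN : ∀ r K t s, ∀ i ∈ N r K t s, 36 * HN r K t s i * 1 ^ 2 / (RN r K t s i - 1) ^ 2 ≤ δN r K t s i * θN r K t s i)
    (hANN : ∀ r K t s, ∀ i ∈ N r K t s, ∀ V, ∀ x ∈ closedBall (0 : Fin (m₀ r K s) → ℝ) S, ∀ p ∈ PuN r K t s i, ∃ f : ℂ → AN r K s, DifferentiableOn ℂ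
      f (ball 0 (RN r K t s i)) ∧ (∀ w ∈ ball (0 : ℂ) (RN r K t s i), ‖f w‖ ≤ HN r K t s i) ∧ f 0 = 0 ∧ ∀ c : ℝ, 0 ≤ c → c ≤ 1 → f (c : ℂ) = holN r K
      t s i V p (c • x) - 1)
    {δ : ℝ}
    -- ══ ROW S109 (R-ne7cp1-g36-12 (4)): the u-tuple's carrier READ as the (19)∕(98) source space on the block's …
    (Λu : ∀ r K (t : ℝ) s, Finset (B7Prop1Explicit.Site (P r K s).d × Fin (P r K s).d))
    (U₀u : ∀ r K (t : ℝ) s, B7Prop1Explicit.Site (P r K s).d → Fin (P r K s).d → (Matrix n n ℂ)ˣ)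
    (hU₀u : ∀ r K t s, ∀ y κ, U₀u r K t s y κ ∈ U1 (Matrix n n ℂ)) (wu : ∀ r K t s, ↥(Λu r K t s) → ℝ) (wu' : ∀ r K t s, ↥(covIdx (Λu r K t s)) → ℝ)
    [∀ r K t s, Fact (∀ b, 0 < wu r K t s b)] [∀ r K t s, Fact (∀ i, 0 < wu' r K t s i)] {w₀ w₀' : ℝ} (hw₀ : 0 < w₀) (hw₀' : 0 < w₀')
    (hfl : ∀ r K t s, ∀ b, w₀ ≤ wu r K t s b) (hfl' : ∀ r K t s, ∀ i, w₀' ≤ wu' r K t s i)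
    (𝒢 : ∀ r K t s, GaugeField (P r K s) (jl r K s) SU2 → (𝒵 r K s →L[ℂ] (Ysp (Λu r K t s) (η r (jl r K s)) (U₀u r K t s) (wu r K t s) (wu' r K t
      s))))
    (W𝒱 : ∀ r K t s, GaugeField (P r K s) (jl r K s) SU2 → (Ysp (Λu r K t s) (η r (jl r K s)) (U₀u r K t s) (wu r K t s) (wu' r K t s)) → 𝒵 r K s)
    {B₀ C₄ a₃ ε₄ : ℝ} (h𝒢 : ∀ r K t s, ∀ V f, ‖𝒢 r K t s V f‖ ≤ B₀ * ‖f‖) (hW : ∀ r K t s, ∀ V, Prop4Hyp (W𝒱 r K t s V) C₄ a₃) (hB₀ : 0 < B₀)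
    (hC₄ : 0 ≤ C₄) (hε₄ : 0 ≤ ε₄) {dL C₁ B₃ ε₁ : ℝ} (hdL : 0 ≤ dL) (hC₁ : 0 ≤ C₁) (hε₁ : 0 ≤ ε₁) (hB₃ : dL ≤ B₃) (h1 : 2 * B₀ * C₁ * B₃ * ε₁ ≤ ε₄)
    (h2 : 4 * ε₄ ≤ a₃) (h3 : 16 * B₀ * C₄ * ε₄ ≤ 1)
    (H₁ : ∀ r K t s, GaugeField (P r K s) (jl r K s) SU2 → (ℬ r K s →L[ℂ] (Ysp (Λu r K t s) (η r (jl r K s)) (U₀u r K t s) (wu r K t s) (wu' r K t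
      s))))
    (hH₁ : ∀ r K t s, ∀ V B, ‖H₁ r K t s V B‖ ≤ B₀ * ‖B‖)
    (TΦ : ∀ r K (t : ℝ) s, GaugeField (P r K s) (jl r K s) SU2 → ((Fin (m₀ r K s) → ℂ) →L[ℂ] (ℬ r K s))) {rΦ : ℝ}
    (hTb : ∀ r K t s, ∀ V, ‖TΦ r K t s V‖ * rΦ < 2 * dL * C₁ * ε₁) (hSr : S < rΦ) (k : Bool → ℕ → σ → ℕ)
    (Sf Sf' Sw Sw' Se Se' : ∀ r K s, Finset (B7Prop1Explicit.Site (P r K s).d × Fin (P r K s).d))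
    (Ubg : ∀ r K (t : ℝ) s, GaugeField (P r K s) (jl r K s) SU2 → B7Prop1Explicit.Site (P r K s).d → Fin (P r K s).d → (𝔸 r K s)ˣ)
    (hUbg : ∀ r K t s, ∀ V x κ, Ubg r K t s V x κ ∈ unitaryUnits (𝔸 r K s)) {α₀ : ℝ} (hα : 0 < α₀) (hα3 : ∀ r K s, C0 (P r K s).d * α₀ ≤ 1 / 3)
    (hα4 : ∀ r K s, 4 * α₀ ≤ c2' (P r K s).d (P r K s).L) (hα6 : ∀ r K s, 4 * O1cov (P r K s).d * α₀ ≤ 1 / 3)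
    (h52locw : ∀ r K t s, ∀ V (c : ↥(Sw' r K s)), pdevOn (loK (P r K s).L (k r K s) c.1.1) (bondHiK (P r K s).L (k r K s) c.1.1 c.1.2) (Ubg r K t s V)
      < α₀ * ((((P r K s).L : ℝ) ^ k r K s)⁻¹) ^ 2)
    (h52loce : ∀ r K t s, ∀ V (c : ↥(Se' r K s)), pdevOn (loK (P r K s).L (k r K s) c.1.1) (bondHiK (P r K s).L (k r K s) c.1.1 c.1.2) (Ubg r K t s V)
      < α₀ * ((((P r K s).L : ℝ) ^ k r K s)⁻¹) ^ 2)
    (ϖe₁ : ∀ r K (t : ℝ) s, ↥(Se r K s) → ℝ) (ϖe₂ : ∀ r K (t : ℝ) s, ↥(Se' r K s) → ℝ) (hϖe₁ : ∀ r K t s, ∀ b, 0 ≤ ϖe₁ r K t s b)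
    (hϖe₂ : ∀ r K t s, ∀ c, 0 ≤ ϖe₂ r K t s c) {r₀e : ℝ}
    (hreache : ∀ r K t s, ∀ (c : ↥(Se' r K s)) (b : ↥(Se r K s)), BondIn (loK (P r K s).L (k r K s) c.1.1) (bondHiK (P r K s).L (k r K s) c.1.1 c.1.2)
      b.1.1 b.1.2 → ϖe₂ r K t s c - r₀e ≤ ϖe₁ r K t s b)
    (ιs : ∀ r K t s, GaugeField (P r K s) (jl r K s) SU2 → ((Ysp (Λu r K t s) (η r (jl r K s)) (U₀u r K t s) (wu r K t s) (wu' r K t s)) →L[ℂ] (↥(Sf r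
      K s) → 𝔸 r K s)))
    (hι : ∀ r K t s, ∀ V Y, ‖ιs r K t s V Y‖ ≤ ‖Y‖)
    (Hop : ∀ r K t s, GaugeField (P r K s) (jl r K s) SU2 → ((↥(Sf' r K s) → 𝔸 r K s) →L[ℂ] (Ysp (Λu r K t s) (η r (jl r K s)) (U₀u r K t s) (wu r K t
      s) (wu' r K t s))))
    (hH : ∀ r K t s, ∀ V X, ‖Hop r K t s V X‖ ≤ B₀ * ‖X‖) {ε₃ : ℝ} (h18 : ∀ r K s, 18 * C2cov (P r K s).d * B₀ * ε₃ ≤ 1)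
    (hcoup : ε₄ + B₀ * (2 * dL * C₁ * ε₁) ≤ ε₃) (h3R : ∀ r K s, 3 * ε₃ ≤ landauRad (P r K s).d (P r K s).L) {Λw Λz Λb : Bool → ℕ → σ → Type*}
    [∀ r K s, Fintype (Λw r K s)] [∀ r K s, DecidableEq (Λw r K s)] [∀ r K s, Fintype (Λz r K s)] [∀ r K s, Fintype (Λb r K s)]
    {𝔄w ℭ 𝔇 : Bool → ℕ → σ → Type*} [∀ r K s, NormedAddCommGroup (𝔄w r K s)] [∀ r K s, NormedSpace ℂ (𝔄w r K s)] [∀ r K s, CompleteSpace (𝔄w r K s)]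
    [∀ r K s, NormedAddCommGroup (ℭ r K s)] [∀ r K s, NormedSpace ℂ (ℭ r K s)] [∀ r K s, NormedAddCommGroup (𝔇 r K s)]
    [∀ r K s, NormedSpace ℂ (𝔇 r K s)] {δw : ℝ} (hδw : 0 ≤ δw) {Nc : Bool → ℕ → σ → ℕ} [∀ r K s, NeZero (Nc r K s)]
    (Bref : ∀ r K (t : ℝ) s, Finset (TPt (P r K s).d (Nc r K s))) (hBref : ∀ r K t s, (Bref r K t s).Nonempty)
    (pos : ∀ r K (t : ℝ) s, Λw r K s → TPt (P r K s).d (Nc r K s)) (posz : ∀ r K (t : ℝ) s, Λz r K s → TPt (P r K s).d (Nc r K s))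
    (pos' : ∀ r K (t : ℝ) s, ↥(Sw r K s) → TPt (P r K s).d (Nc r K s)) (posx : ∀ r K (t : ℝ) s, ↥(Sw' r K s) → TPt (P r K s).d (Nc r K s))
    (posb : ∀ r K (t : ℝ) s, Λb r K s → TPt (P r K s).d (Nc r K s)) {multw multz multx multb : ℕ}
    (hmultw : ∀ r K t s, ∀ x, (Finset.univ.filter fun b' => pos r K t s b' = x).card ≤ multw)
    (hmultz : ∀ r K t s, ∀ x, (Finset.univ.filter fun b' => posz r K t s b' = x).card ≤ multz)
    (hmultx : ∀ r K t s, ∀ x, (Finset.univ.filter fun b' => posx r K t s b' = x).card ≤ multx)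
    (hmultb : ∀ r K t s, ∀ x, (Finset.univ.filter fun b' => posb r K t s b' = x).card ≤ multb)
    (k𝒢 : ∀ r K (t : ℝ) s, GaugeField (P r K s) (jl r K s) SU2 → Λw r K s → Λz r K s → (ℭ r K s →L[ℂ] (𝔄w r K s)))
    (kι : ∀ r K (t : ℝ) s, GaugeField (P r K s) (jl r K s) SU2 → ↥(Sw r K s) → Λw r K s → (𝔄w r K s →L[ℂ] (𝔸 r K s)))
    (kH : ∀ r K (t : ℝ) s, GaugeField (P r K s) (jl r K s) SU2 → Λw r K s → ↥(Sw' r K s) → (𝔸 r K s →L[ℂ] (𝔄w r K s)))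
    (kH₁ : ∀ r K (t : ℝ) s, GaugeField (P r K s) (jl r K s) SU2 → Λw r K s → Λb r K s → (𝔇 r K s →L[ℂ] (𝔄w r K s)))
    {c𝒢 δ𝒢 M𝒢 cι δι Mι cH δH MH cH₁ δH₁ MH₁ : ℝ} (hc𝒢 : 0 ≤ c𝒢)
    (hk𝒢 : ∀ r K t s, ∀ V c b', ‖k𝒢 r K t s V c b'‖ ≤ c𝒢 * Real.exp (-(δ𝒢 * pl1 (pos r K t s c - posz r K t s b')))) (hgap𝒢 : δw < δ𝒢)
    (hM𝒢c : ∀ r K s, (multz : ℝ) * (2 * (((P r K s).d : ℝ) + (δ𝒢 - δw)) / (δ𝒢 - δw)) ^ (P r K s).d ≤ M𝒢) (hcι : 0 ≤ cι)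
    (hkι : ∀ r K t s, ∀ V c b', ‖kι r K t s V c b'‖ ≤ cι * Real.exp (-(δι * pl1 (pos' r K t s c - pos r K t s b')))) (hgapι : δw < δι)
    (hMιc : ∀ r K s, (multw : ℝ) * (2 * (((P r K s).d : ℝ) + (δι - δw)) / (δι - δw)) ^ (P r K s).d ≤ Mι) (hcH : 0 ≤ cH)
    (hkH : ∀ r K t s, ∀ V c b', ‖kH r K t s V c b'‖ ≤ cH * Real.exp (-(δH * pl1 (pos r K t s c - posx r K t s b')))) (hgapH : δw < δH)
    (hMHc : ∀ r K s, (multx : ℝ) * (2 * (((P r K s).d : ℝ) + (δH - δw)) / (δH - δw)) ^ (P r K s).d ≤ MH) (hcH₁ : 0 ≤ cH₁)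
    (hkH₁ : ∀ r K t s, ∀ V c b', ‖kH₁ r K t s V c b'‖ ≤ cH₁ * Real.exp (-(δH₁ * pl1 (pos r K t s c - posb r K t s b')))) (hgapH₁ : δw < δH₁)
    (hMH₁c : ∀ r K s, (multb : ℝ) * (2 * (((P r K s).d : ℝ) + (δH₁ - δw)) / (δH₁ - δw)) ^ (P r K s).d ≤ MH₁)
    (W𝒱w : ∀ r K (t : ℝ) s, GaugeField (P r K s) (jl r K s) SU2 → (Λw r K s → 𝔄w r K s) → (Λz r K s → ℭ r K s)) {B₀w C₄w a₃w ε₄w bw : ℝ}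
    (hB𝒢w : c𝒢 * M𝒢 ≤ B₀w) (hWw : ∀ r K t s, ∀ V, Prop4Hyp (W𝒱w r K t s V) C₄w a₃w) (hB₀w : 0 < B₀w) (hC₄w : 0 ≤ C₄w) (hε₄w : 0 ≤ ε₄w)
    (hdomw : 2 * (ε₄w + B₀w * bw) ≤ a₃w) (hselfw : B₀w * C₄w * (ε₄w + B₀w * bw) ^ 2 ≤ ε₄w) (hcontrw : 4 * B₀w * C₄w * (ε₄w + B₀w * bw) < 1)
    (hBH₁w : cH₁ * MH₁ ≤ B₀w) (Tw : ∀ r K (t : ℝ) s, GaugeField (P r K s) (jl r K s) SU2 → ((Fin (m₀ r K s) → ℂ) →L[ℂ] (Λb r K s → 𝔇 r K s)))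
    {rΦw : ℝ} (hTbw : ∀ r K t s, ∀ V, ‖Tw r K t s V‖ * rΦw < bw) (h2Sw : 2 * S ≤ rΦw) (hιw : ∀ r K t s, ∀ V Y, ‖kerOp (kι r K t s V) Y‖ ≤ ‖Y‖)
    (hBHw : cH * MH ≤ B₀w) (hqw : ∀ r K s, 9 * C2cov (P r K s).d * B₀w * (ε₄w + B₀w * bw) < 1)
    (hRCw : ∀ r K s, 6 * (ε₄w + B₀w * bw) ≤ landauRad (P r K s).d (P r K s).L) (NW : ∀ r K (t : ℝ) s, Λz r K s → Λw r K s → Prop)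
    (hlocW : ∀ r K t s, ∀ V, ∀ A A' : Λw r K s → 𝔄w r K s, ∀ c', (∀ b', NW r K t s c' b' → A b' = A' b') → W𝒱w r K t s V A c' = W𝒱w r K t s V A' c')
    {rW : ℝ}
    (hreachW : ∀ r K t s, ∀ c' b', NW r K t s c' b' → pinDist (Bref r K t s) (hBref r K t s) (posz r K t s c') - rW ≤ pinDist (Bref r K t s) (hBref r
      K t s) (pos r K t s b'))
    {rC : ℝ}
    (hreachC : ∀ r K t s, ∀ (c' : ↥(Sw' r K s)) (b' : ↥(Sw r K s)), BondIn (loK (P r K s).L (k r K s) c'.1.1) (bondHiK (P r K s).L (k r K s) c'.1.1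
      c'.1.2) b'.1.1 b'.1.2 → pinDist (Bref r K t s) (hBref r K t s) (posx r K t s c') - rC ≤ pinDist (Bref r K t s) (hBref r K t s) (pos' r K t s
      b'))
    (hsupp : ∀ r K t s, ∀ V, ∀ z : Fin (m₀ r K s) → ℂ, ∀ i, 0 < pinDist (Bref r K t s) (hBref r K t s) (posb r K t s i) → Tw r K t s V z i = 0)
    (hqW : c𝒢 * M𝒢 * (2 * C₄w * a₃w * Real.exp (δw * rW)) < 1)
    (hk : ∀ r K s, 2 * C2cov (P r K s).d * landauRad (P r K s).d (P r K s).L * Real.exp (δw * rC) * (cι * Mι) * (cH * MH) < 1)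
    {𝔭 : Bool → ℕ → σ → Type*} (Pw : ∀ r K (t : ℝ) s, Finset (𝔭 r K s))
    (ℓw : ∀ r K (t : ℝ) s, 𝔭 r K s → List ((Λw r K s → 𝔄w r K s) →L[ℂ] Matrix n n ℂ)) (suppw : ∀ r K (t : ℝ) s, 𝔭 r K s → Finset (Λw r K s))
    (ϖPw : ∀ r K (t : ℝ) s, 𝔭 r K s → ℝ)
    (hblindw : ∀ r K t s, ∀ p ∈ Pw r K t s, ∀ ℓ ∈ ℓw r K t s p, ∀ A A' : Λw r K s → 𝔄w r K s, (∀ b' ∈ suppw r K t s p, A b' = A' b') → ℓ A = ℓ A')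
    (hdepthw : ∀ r K t s, ∀ p ∈ Pw r K t s, ∀ b' ∈ suppw r K t s p, ϖPw r K t s p ≤ pinDist (Bref r K t s) (hBref r K t s) (pos r K t s b'))
    (hϖPw : ∀ r K t s, ∀ p ∈ Pw r K t s, 0 ≤ ϖPw r K t s p) {κwb κcb : Bool → ℕ → ℝ} (hκwb : ∀ r K s, 0 ≤ κwb r (jl r K s))
    (hκcb : ∀ r K s, 0 ≤ κcb r (jl r K s)) (hℓwb : ∀ r K t s, ∀ p ∈ Pw r K t s, ∀ ℓ ∈ ℓw r K t s p, ‖ℓ‖ ≤ κwb r (jl r K s))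
    (hcurlw : ∀ r K t s, ∀ p ∈ Pw r K t s, ‖(ℓw r K t s p).sum‖ ≤ κcb r (jl r K s)) {mw : ℕ}
    (hlenw : ∀ r K t s, ∀ p ∈ Pw r K t s, (ℓw r K t s p).length ≤ mw) (𝓡𝒴w : ∀ r K (t : ℝ) s, AddSubgroup (Λw r K s → 𝔄w r K s))
    (h𝓡𝒴w : ∀ r K t s, IsClosed (𝓡𝒴w r K t s : Set (Λw r K s → 𝔄w r K s))) (𝓡𝒵w : ∀ r K (t : ℝ) s, AddSubgroup (Λz r K s → ℭ r K s))
    (𝓡ℬw : ∀ r K (t : ℝ) s, AddSubgroup (Λb r K s → 𝔇 r K s)) (h𝒢rw : ∀ r K t s, ∀ V, ∀ f ∈ 𝓡𝒵w r K t s, kerOp (k𝒢 r K t s V) f ∈ 𝓡𝒴w r K t s)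
    (hWrw : ∀ r K t s, ∀ V, ∀ Y ∈ 𝓡𝒴w r K t s, W𝒱w r K t s V Y ∈ 𝓡𝒵w r K t s)
    (hιrw : ∀ r K t s, ∀ V, ∀ Y ∈ 𝓡𝒴w r K t s, kerOp (kι r K t s V) Y ∈ skewPi ↥(Sw r K s))
    (hHrw : ∀ r K t s, ∀ V, ∀ X ∈ skewPi (𝔸 := 𝔸 r K s) ↥(Sw' r K s), kerOp (kH r K t s V) X ∈ 𝓡𝒴w r K t s)
    (hH₁rw : ∀ r K t s, ∀ V, ∀ B ∈ 𝓡ℬw r K t s, kerOp (kH₁ r K t s V) B ∈ 𝓡𝒴w r K t s)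
    (hTrw : ∀ r K t s, ∀ V (y : Fin (m₀ r K s) → ℝ), Tw r K t s V (cplx y) ∈ 𝓡ℬw r K t s)
    (hskew : ∀ r K t s, ∀ p ∈ Pw r K t s, ∀ ℓ ∈ ℓw r K t s p, ∀ Y ∈ 𝓡𝒴w r K t s, ℓ Y ∈ skewAdjoint (Matrix n n ℂ))
    (Bp : ∀ r K (t : ℝ) s, GaugeField (P r K s) (jl r K s) SU2 → 𝔭 r K s → Matrix n n ℂ) {d : ∀ r K (t : ℝ) s, 𝔭 r K s → ℝ} {dbar : Bool → ℕ → ℝ}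
    (hBu : ∀ r K t s, ∀ V, ∀ p ∈ Pw r K t s, Bp r K t s V p ∈ unitary (Matrix n n ℂ))
    (hBd : ∀ r K t s, ∀ V, ∀ p ∈ Pw r K t s, ‖Bp r K t s V p - 1‖ ≤ d r K t s p) (hd : ∀ r K t s, ∀ p ∈ Pw r K t s, d r K t s p ≤ dbar r (jl r K s))
    (hdbar : ∀ r K s, 0 ≤ dbar r (jl r K s)) {Kw : Bool → ℕ → ℝ}
    (hKw : ∀ r K t s, ∑ p ∈ Pw r K t s, Real.exp (-(δw * ϖPw r K t s p)) ≤ Kw r (jl r K s)) {Λe : Bool → ℕ → σ → Type*} [∀ r K s, Fintype (Λe r K s)]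
    {𝔄 : Bool → ℕ → σ → Type*} [∀ r K s, NormedAddCommGroup (𝔄 r K s)] [∀ r K s, NormedSpace ℂ (𝔄 r K s)] [∀ r K s, CompleteSpace (𝔄 r K s)] {δ' : ℝ}
    {ϖ : ∀ r K (t : ℝ) s, Λe r K s → ℝ} (hδ' : 0 ≤ δ') (hϖ : ∀ r K t s, ∀ b', 0 ≤ ϖ r K t s b') {𝒵e ℬe : Bool → ℕ → σ → Type*}
    [∀ r K s, NormedAddCommGroup (𝒵e r K s)] [∀ r K s, NormedSpace ℂ (𝒵e r K s)] [∀ r K s, NormedAddCommGroup (ℬe r K s)]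
    [∀ r K s, NormedSpace ℂ (ℬe r K s)]
    (𝒢e : ∀ r K t s, GaugeField (P r K s) (jl r K s) SU2 → (𝒵e r K s →L[ℂ] WSup (pinW δ' (ϖ r K t s)) 1 (𝔄 r K s)))
    (W𝒱e : ∀ r K t s, GaugeField (P r K s) (jl r K s) SU2 → WSup (pinW δ' (ϖ r K t s)) 1 (𝔄 r K s) → 𝒵e r K s) {B₀e C₄e a₃e be ε₄e : ℝ}
    (h𝒢e : ∀ r K t s, ∀ V f, ‖𝒢e r K t s V f‖ ≤ B₀e * ‖f‖) (hWe : ∀ r K t s, ∀ V, Prop4Hyp (W𝒱e r K t s V) C₄e a₃e) (hB₀e : 0 < B₀e) (hC₄e : 0 ≤ C₄e)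
    (hbe : 0 ≤ be) (hε₄e : 0 ≤ ε₄e) (hdome : 2 * (ε₄e + B₀e * be) ≤ a₃e) (hselfe : B₀e * C₄e * (ε₄e + B₀e * be) ^ 2 ≤ ε₄e)
    (hcontre : 4 * B₀e * C₄e * (ε₄e + B₀e * be) < 1)
    (H₁e : ∀ r K t s, GaugeField (P r K s) (jl r K s) SU2 → (ℬe r K s →L[ℂ] WSup (pinW δ' (ϖ r K t s)) 1 (𝔄 r K s)))
    (hH₁e : ∀ r K t s, ∀ V B, ‖H₁e r K t s V B‖ ≤ B₀e * ‖B‖)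
    (Te : ∀ r K (t : ℝ) s, GaugeField (P r K s) (jl r K s) SU2 → ((Fin (m₀ r K s) → ℂ) →L[ℂ] (ℬe r K s))) {rΦe : ℝ}
    (hTbe : ∀ r K t s, ∀ V, ‖Te r K t s V‖ * rΦe < be) (hSre : S < rΦe)
    (ιe : ∀ r K t s, GaugeField (P r K s) (jl r K s) SU2 → (WSup (pinW δ' (ϖ r K t s)) 1 (𝔄 r K s) →L[ℂ] WSup (pinW δ' (ϖe₁ r K t s)) 1 (𝔸 r K s)))
    (hιe : ∀ r K t s, ∀ V Y, ‖ιe r K t s V Y‖ ≤ ‖Y‖)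
    (He : ∀ r K t s, GaugeField (P r K s) (jl r K s) SU2 → (WSup (pinW δ' (ϖe₂ r K t s)) 1 (𝔸 r K s) →L[ℂ] WSup (pinW δ' (ϖ r K t s)) 1 (𝔄 r K s)))
    (hHe : ∀ r K t s, ∀ V X, ‖He r K t s V X‖ ≤ B₀e * ‖X‖)
    (hqe : ∀ r K s, 9 * (C2cov (P r K s).d * Real.exp (2 * δ' * r₀e)) * B₀e * (ε₄e + B₀e * be) < 1)
    (hRCe : ∀ r K s, 3 * (ε₄e + B₀e * be) ≤ landauRad (P r K s).d (P r K s).L) {𝔱 : Bool → ℕ → σ → Type*} (I : ∀ r K (t : ℝ) s, Finset (𝔱 r K s))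
    {Ef : ∀ r K (t : ℝ) s, 𝔱 r K s → (Λe r K s → 𝔄 r K s) → ℂ} {rE : ℝ} {ee : ∀ r K (t : ℝ) s, 𝔱 r K s → ℝ} (hrE : 0 < rE)
    (hEd : ∀ r K t s, ∀ i ∈ I r K t s, DifferentiableOn ℂ (Ef r K t s i) (ball 0 rE))
    (hEb : ∀ r K t s, ∀ i ∈ I r K t s, ∀ Z ∈ ball (0 : Λe r K s → 𝔄 r K s) rE, ‖Ef r K t s i Z‖ ≤ ee r K t s i)
    (supp : ∀ r K (t : ℝ) s, 𝔱 r K s → Finset (Λe r K s))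
    (hblind : ∀ r K t s, ∀ i ∈ I r K t s, ∀ A₁ A₂ : Λe r K s → 𝔄 r K s, (∀ b' ∈ supp r K t s i, A₁ b' = A₂ b') → Ef r K t s i A₁ = Ef r K t s i A₂)
    (ϖP : ∀ r K (t : ℝ) s, 𝔱 r K s → ℝ) (hdepth : ∀ r K t s, ∀ i ∈ I r K t s, ∀ b' ∈ supp r K t s i, ϖP r K t s i ≤ ϖ r K t s b') {LK : ℝ}
    (hK : ∀ r K t s, ∑ i ∈ I r K t s, 2 * ee r K t s i / rE * Real.exp (-(δ' * ϖP r K t s i)) ≤ LK)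
    (hcoupE : ∀ r K s, ((ε₄e + B₀e * be) + B₀e * (4 * (C2cov (P r K s).d * Real.exp (2 * δ' * r₀e)) * (ε₄e + B₀e * be) ^ 2)) ≤ rE / 2)
    {Ω : Bool → ℕ → σ → Type*} [∀ r K s, MeasurableSpace (Ω r K s)] (μ : ∀ r K (t : ℝ) s, Measure (Ω r K s)) {g : ∀ r K (t : ℝ) s, Ω r K s → ℝ}
    (hg : ∀ r K t s, ∀ ω, 0 ≤ g r K t s ω) (Aex : ∀ r K (t : ℝ) s, GaugeField (P r K s) (jl r K s) SU2 → (Fin (m₀ r K s) → ℝ) → Ω r K s → ℝ) {Bd : ℝ}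
    (hint : ∀ r K t s, ∀ V, ∀ x ∈ closedBall (0 : Fin (m₀ r K s) → ℝ) S, ∀ c : ℝ, 1 / 2 ≤ c → c ≤ 1 → Integrable (fun ω => g r K t s ω * Real.exp (Aex
      r K t s V (c • x) ω)) (μ r K t s))
    (hpos : ∀ r K t s, ∀ V, ∀ x ∈ closedBall (0 : Fin (m₀ r K s) → ℝ) S, ∀ c : ℝ, 1 / 2 ≤ c → c ≤ 1 → 0 < ∫ ω, g r K t s ω * Real.exp (Aex r K t s V
      (c • x) ω) ∂(μ r K t s))
    (hA : ∀ r K t s, ∀ V, ∀ x ∈ closedBall (0 : Fin (m₀ r K s) → ℝ) S, ∀ c : ℝ, 1 / 2 ≤ c → c ≤ 1 → ∀ ω, Aex r K t s V x ω ≤ Aex r K t s V (c • x) ω +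
      (1 - c) * Bd)
    {BE₂ : ℝ}
    (hElb₂ : ∀ r K t s, ∀ V (y : Fin (m₀ r K s) → ℝ), ‖y‖ ≤ S → -BE₂ ≤ (-Real.log (∫ ω, g r K t s ω * Real.exp (Aex r K t s V y ω) ∂(μ r K t s))))
    (L : ∀ r K t s, Set ((Ysp (Λu r K t s) (η r (jl r K s)) (U₀u r K t s) (wu r K t s) (wu' r K t s)) →L[ℂ] Matrix n n ℂ))
    (𝓡𝒵 : ∀ r K (t : ℝ) s, AddSubgroup (𝒵 r K s)) (𝓡ℬ : ∀ r K (t : ℝ) s, AddSubgroup (ℬ r K s))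
    (h𝒢r : ∀ r K t s, ∀ V, ∀ f ∈ 𝓡𝒵 r K t s, 𝒢 r K t s V f ∈ readOutReal (L r K t s))
    (hWr : ∀ r K t s, ∀ V, ∀ Y ∈ readOutReal (L r K t s), W𝒱 r K t s V Y ∈ 𝓡𝒵 r K t s)
    (hιr : ∀ r K t s, ∀ V, ∀ Y ∈ readOutReal (L r K t s), ιs r K t s V Y ∈ skewPi ↥(Sf r K s))
    (hHr : ∀ r K t s, ∀ V, ∀ X ∈ skewPi (𝔸 := 𝔸 r K s) ↥(Sf' r K s), Hop r K t s V X ∈ readOutReal (L r K t s))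
    (hH₁r : ∀ r K t s, ∀ V, ∀ B ∈ 𝓡ℬ r K t s, H₁ r K t s V B ∈ readOutReal (L r K t s))
    (hTr : ∀ r K t s, ∀ V (y : Fin (m₀ r K s) → ℝ), TΦ r K t s V (cplx y) ∈ 𝓡ℬ r K t s)
    (hRdict : ∀ r K t s, ∀ V, ∀ x ∈ cube (m₀ r K s) S, F r K t s (fixTo (combBonds (lo r K s) (hi r K s)) 1 (updateFinset V (Λ r K s) (expFibreChart
      (Λ r K s) 1 (e r K s) x))) = (closedBall (0 : Fin (m₀ r K s) → ℝ) S ∩ ⋂ i ∈ N r K t s, {y | classifier (hPuN r K t s i) (holN r K t s i V) y <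
      θN r K t s i}).indicator (1 : (Fin (m₀ r K s) → ℝ) → ℝ≥0∞) x * ENNReal.ofReal (Real.exp (-((∑ p ∈ Pw r K t s, β r (jl r K s) * (1 -
      (Matrix.trace (Bp r K t s V p * holOf (ℓw r K t s p) (fun y => landauExp (landauCfBox (P r K s).L (Ubg r K t s V) (k r K s) (Sw r K s) (Sw' r K
      s) (landauRad (P r K s).d (P r K s).L)) (kerOp (kι r K t s V)) (kerOp (kH r K t s V)) (4 * C2cov (P r K s).d * (ε₄w + B₀w * bw) ^ 2) (solAt
      (kerOp (k𝒢 r K t s V)) 0 (W𝒱w r K t s V) ε₄w (0 : Λz r K s → ℭ r K s) (kerOp (kH₁ r K t s V) (Tw r K t s V (cplx y))) + kerOp (kH₁ r K t s V)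
      (Tw r K t s V (cplx y)))) x)).re / Fintype.card n)) + ((∑ i ∈ I r K t s, Ef r K t s i (WSup.toPiL (𝔄 := 𝔄 r K s) (pinW δ' (ϖ r K t s)) 1
      (landauExp (fun Y : WSup (pinW δ' (ϖe₁ r K t s)) 1 (𝔸 r K s) => ((toPiL (pinW δ' (ϖe₂ r K t s)) 1).symm (landauCf (P r K s).L (Ubg r K t s V) (k
      r K s) (Se r K s) (Se' r K s) (toPiL (pinW δ' (ϖe₁ r K t s)) 1 Y)) : WSup (pinW δ' (ϖe₂ r K t s)) 1 (𝔸 r K s))) (ιe r K t s V) (He r K t s V) (4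
      * (C2cov (P r K s).d * Real.exp (2 * δ' * r₀e)) * (ε₄e + B₀e * be) ^ 2) (solAt (𝒢e r K t s V) 0 (W𝒱e r K t s V) ε₄e (0 : 𝒵e r K s) (H₁e r K t s
      V (Te r K t s V (cplx x))) + H₁e r K t s V (Te r K t s V (cplx x)))))).re + (-Real.log (∫ ω, g r K t s ω * Real.exp (Aex r K t s V x ω) ∂(μ r K
      t s))))))))
    (hudict : ∀ r K t s, ∀ V, ∀ x ∈ cube (m₀ r K s) S, u r K t s (fixTo (combBonds (lo r K s) (hi r K s)) 1 (updateFinset V (Λ r K s) (expFibreChart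
      (Λ r K s) 1 (e r K s) x))) = classifier (hPu r K t s) (fun p => holOf (plaqReadOuts (Λu r K t s) (η r (jl r K s)) (U₀u r K t s) (wu r K t s)
      (wu' r K t s) (plq r K t s p).1 (plq r K t s p).2.1 (plq r K t s p).2.2) (fun y => landauExp ((ball (0 : ↥(Sf r K s) → 𝔸 r K s) (landauRad (P r
      K s).d (P r K s).L)).indicator (landauCf (P r K s).L (1 : B7Prop1Explicit.Site (P r K s).d → Fin (P r K s).d → (𝔸 r K s)ˣ) (k r K s) (Sf r K s)
      (Sf' r K s))) (ιs r K t s V) (Hop r K t s V) (4 * C2cov (P r K s).d * (ε₄ + B₀ * (2 * dL * C₁ * ε₁)) ^ 2) (solAt (𝒢 r K t s V) 0 (W𝒱 r K t s V)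
      ε₄ (0 : 𝒵 r K s) (H₁ r K t s V (TΦ r K t s V (cplx y))) + H₁ r K t s V (TΦ r K t s V (cplx y))))) x)
    (hδ0 : 0 ≤ δ) (hδ1 : δ < 1) {c₁ c₂ zs : ℝ}
    -- (SM) IN η-FREE NUMBERS (S109 f1 `smRows_of_etaFree`; ROW S95's LIFT RULE): with `κr := η∕w₀`, `κc := 2η²∕w₀ …
    (hη1 : ∀ r K s, η r (jl r K s) ≤ 1)
    (hs₁' : ∀ r K s, 2 * ((ε₄ + B₀ * (2 * dL * C₁ * ε₁)) + B₀ * (4 * C2cov (P r K s).d * (ε₄ + B₀ * (2 * dL * C₁ * ε₁)) ^ 2)) ≤ c₁ * w₀' ^ 2 * zs)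
    (ha' : ∀ r K s, ((ε₄ + B₀ * (2 * dL * C₁ * ε₁)) + B₀ * (4 * C2cov (P r K s).d * (ε₄ + B₀ * (2 * dL * C₁ * ε₁)) ^ 2)) ≤ c₂ * w₀ * zs)
    (hma' : ∀ r K s, 4 * ((ε₄ + B₀ * (2 * dL * C₁ * ε₁)) + B₀ * (4 * C2cov (P r K s).d * (ε₄ + B₀ * (2 * dL * C₁ * ε₁)) ^ 2)) ≤ w₀)
    (hsm : ∀ r K s, 36 * (c₁ * zs + (4 : ℕ) ^ 2 * c₂ ^ 2 * zs ^ 2) / (rΦ / S - 1) ^ 2 ≤ δ * ε r (K - lvl r K s)) {a : ℝ} (ha0 : 0 ≤ a)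
    (hrad : ∀ r K s, (((P r K s).d - 1 : ℕ) : ℝ) * nb r K s * a ≤ 2 * Real.sin (S / 2))
    {Pcore Pcollar : ∀ r K (t : ℝ) s, Set (Plaq (P r K s) (jl r K s))}
    (hcover : ∀ r K t s, boxPlaqs (lo r K s) (hi r K s) ⊆ Pcore r K t s ∪ (Pcollar r K t s))
    (hcore : ∀ r K t s, ∀ (V : GaugeField (P r K s) (jl r K s) SU2) (y : ↥(Λ r K s) → SU2), u r K t s (fixTo (combBonds (lo r K s) (hi r K s)) 1
      (updateFinset V (Λ r K s) y)) < ε r (K - lvl r K s) * η r (jl r K s) ^ 2 → PlaqSmallOn (Pcore r K t s) a (fixTo (combBonds (lo r K s) (hi r K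
      s)) 1 (updateFinset V (Λ r K s) y)))
    (hcollar : ∀ r K t s, ∀ (V : GaugeField (P r K s) (jl r K s) SU2) (y : ↥(Λ r K s) → SU2), F r K t s (fixTo (combBonds (lo r K s) (hi r K s)) 1
      (updateFinset V (Λ r K s) y)) ≠ 0 → PlaqSmallOn (Pcollar r K t s) a (fixTo (combBonds (lo r K s) (hi r K s)) 1 (updateFinset V (Λ r K s) y)))
    (hρ : ∀ r j, ρ r j ≤ (1 - δ) / 2) (hβ : ∀ r j, 0 ≤ β r j)
    :
    ∀ (r : Bool) (K : ℕ) (t : ℝ) (s : σ), SlotAntiConcentration ((fieldMeasure (P r K s) (jl r K s) SU2).withDensity (F r K t s)) (fun U => u r K t s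
      U / η r (jl r K s) ^ 2) (ε r (K - lvl r K s)) (ρ r (lvl r K s)) (2 * ((m₀ r K s : ℝ) + (3 * (|β r (jl r K s)| * ((dbar r (jl r K s) + 2 * (κcb r
      (jl r K s) * (cH₁ * MH₁ * bw / ((1 - c𝒢 * M𝒢 * (2 * C₄w * a₃w * Real.exp (δw * rW))) * (1 - 2 * C2cov (P r K s).d * landauRad (P r K s).d (P r K
      s).L * Real.exp (δw * rC) * (cι * Mι) * (cH * MH)))) + expTail₂ (mw * (κwb r (jl r K s) * (cH₁ * MH₁ * bw / ((1 - c𝒢 * M𝒢 * (2 * C₄w * a₃w *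
      Real.exp (δw * rW))) * (1 - 2 * C2cov (P r K s).d * landauRad (P r K s).d (P r K s).L * Real.exp (δw * rC) * (cι * Mι) * (cH * MH))))))) / (rΦw
      / S)) * (2 * (κcb r (jl r K s) * (cH₁ * MH₁ * bw / ((1 - c𝒢 * M𝒢 * (2 * C₄w * a₃w * Real.exp (δw * rW))) * (1 - 2 * C2cov (P r K s).d *
      landauRad (P r K s).d (P r K s).L * Real.exp (δw * rC) * (cι * Mι) * (cH * MH)))) + expTail₂ (mw * (κwb r (jl r K s) * (cH₁ * MH₁ * bw / ((1 -
      c𝒢 * M𝒢 * (2 * C₄w * a₃w * Real.exp (δw * rW))) * (1 - 2 * C2cov (P r K s).d * landauRad (P r K s).d (P r K s).L * Real.exp (δw * rC) * (cι *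
      Mι) * (cH * MH))))))) / (rΦw / S))) * Kw r (jl r K s)) + (3 * (LK * (2 * ((ε₄e + B₀e * be) + B₀e * (4 * (C2cov (P r K s).d * Real.exp (2 * δ' *
      r₀e)) * (ε₄e + B₀e * be) ^ 2)))) / (rΦe / S - 1) + Bd))) / (1 - δ)) :=
  fun r K t s => slotAntiConcentration_thresholdUnits (hη r (jl r K s))
    (slotAC_realized_su2_landauChart_assembled_decay_cfB7_lin_coTests_schur_elb_coarse_readOuts (hn r K s) (hN r K s) (Λ r K s) (hΛbox r K s) (hΛcomb r K s) (e r K s) hS hSπ (hF r K t s) (hFi r K t s) (hu r K t s) (hui r K t s)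
      (hPu r K t s) (plq r K t s) (N r K t s) (hPuN r K t s) (holN r K t s) (hRN r K t s) (hθN r K t s) (hδ0N r K t s) (hδ1N r K t s) (hSMN r K t s)
      (hANN r K t s) (Λu r K t s) (U₀u r K t s) (hU₀u r K t s) (wu r K t s) (wu' r K t s) hw₀ hw₀' (hfl r K t s) (hfl' r K t s) (𝒢 r K t s) (W𝒱 r K t
      s) (h𝒢 r K t s) (hW r K t s) hB₀ hC₄ hε₄ hdL hC₁ hε₁ hB₃ h1 h2 h3 (H₁ r K t s) (hH₁ r K t s) (TΦ r K t s) (hTb r K t s) hSr (k r K s) (Sf r K s)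
      (Sf' r K s) (Sw r K s) (Sw' r K s) (Se r K s) (Se' r K s) (Ubg r K t s) (hUbg r K t s) hα (hα3 r K s) (hα4 r K s) (hα6 r K s) (h52locw r K t s)
      (h52loce r K t s) (ϖe₁ r K t s) (ϖe₂ r K t s) (hϖe₁ r K t s) (hϖe₂ r K t s) (hreache r K t s) (ιs r K t s) (hι r K t s) (Hop r K t s) (hH r K t
      s) (h18 r K s) hcoup (h3R r K s) hδw (Bref r K t s) (hBref r K t s) (pos r K t s) (posz r K t s) (pos' r K t s) (posx r K t s) (posb r K t s)
      (hmultw r K t s) (hmultz r K t s) (hmultx r K t s) (hmultb r K t s) (k𝒢 r K t s) (kι r K t s) (kH r K t s) (kH₁ r K t s) hc𝒢 (hk𝒢 r K t s) hgap𝒢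
      (hM𝒢c r K s) hcι (hkι r K t s) hgapι (hMιc r K s) hcH (hkH r K t s) hgapH (hMHc r K s) hcH₁ (hkH₁ r K t s) hgapH₁ (hMH₁c r K s) (W𝒱w r K t s)
      hB𝒢w (hWw r K t s) hB₀w hC₄w hε₄w hdomw hselfw hcontrw hBH₁w (Tw r K t s) (hTbw r K t s) h2Sw (hιw r K t s) hBHw (hqw r K s) (hRCw r K s) (NW r
      K t s) (hlocW r K t s) (hreachW r K t s) (hreachC r K t s) (hsupp r K t s) hqW (hk r K s) (Pw r K t s) (ℓw r K t s) (suppw r K t s) (ϖPw r K t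
      s) (hblindw r K t s) (hdepthw r K t s) (hϖPw r K t s) (hκwb r K s) (hκcb r K s) (hℓwb r K t s) (hcurlw r K t s) (hlenw r K t s) (𝓡𝒴w r K t s)
      (h𝓡𝒴w r K t s) (𝓡𝒵w r K t s) (𝓡ℬw r K t s) (h𝒢rw r K t s) (hWrw r K t s) (hιrw r K t s) (hHrw r K t s) (hH₁rw r K t s) (hTrw r K t s) (hskew r K
      t s) (Bp r K t s) (hBu r K t s) (hBd r K t s) (hd r K t s) (hdbar r K s) (hKw r K t s) hδ' (hϖ r K t s) (𝒢e r K t s) (W𝒱e r K t s) (h𝒢e r K t s)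
      (hWe r K t s) hB₀e hC₄e hbe hε₄e hdome hselfe hcontre (H₁e r K t s) (hH₁e r K t s) (Te r K t s) (hTbe r K t s) hSre (ιe r K t s) (hιe r K t s)
      (He r K t s) (hHe r K t s) (hqe r K s) (hRCe r K s) (I r K t s) hrE (hEd r K t s) (hEb r K t s) (supp r K t s) (hblind r K t s) (ϖP r K t s)
      (hdepth r K t s) (hK r K t s) (hcoupE r K s) (μ r K t s) (hg r K t s) (Aex r K t s) (hint r K t s) (hpos r K t s) (hA r K t s) (hElb₂ r K t s)
      (L r K t s) (𝓡𝒵 r K t s) (𝓡ℬ r K t s) (h𝒢r r K t s) (hWr r K t s) (hιr r K t s) (hHr r K t s) (hH₁r r K t s) (hTr r K t s) (hRdict r K t s)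
      (hudict r K t s) hδ0 hδ1 (hρ0 r (lvl r K s)) (hρ r (lvl r K s)) (hβ r (jl r K s)) (hη r (jl r K s)) (hε r (K - lvl r K s)) (hη1 r K s) (hs₁' r K
      s) (ha' r K s) (hma' r K s) (hsm r K s) ha0 (hrad r K s) (hcover r K t s) (hcore r K t s) (hcollar r K t s))

end Summit.QuantumFields.BalabanUV.T4Continuum.ShellMeasureLiveEndOneCallSlotLevelsCfLinJunction

end
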